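import Summits.HubbardSuperconductivity.HubbardSuperconductivity.Theorems.LevyLogBootstrapDressHalfFilledKernelStructure
import HarnessLib

/-!
# Route `LevyLogBootstrap` / `AnisotropyChord`, crux `DressHalfFilled` (stmt-HubbardSuperconductivity-8148), stub 2
# `stub_plaquetteDictionary`: THE TWO-PLAQUETTE KERNEL TABLE FROM THE PLAQUETTE DATA (W4) — no `U`-window

Support file (`--supports stmt-HubbardSuperconductivity-8148`). `…KernelSymmetry` / `…KernelStructure` identify Kato's
two-plaquette kernel `K = plaquetteKernel U` with the one-bond hard-core boson table
`K(κ', κ) = if κ' = κ then Re K(κ,κ) else if (κ'.1 ≠ κ'.2 ∧ κ = κ'.swap) then -J(U) else 0` (and the same table on vertical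
bonds) for `U ∈ [2, 4]`. The window enters those proofs at exactly ONE point: the simplicity of the `(4,0)` and `(2,0)`
plaquette sector ground states (`plaquette_vacuumGS_unique hU`, `plaquette_pairGS_unique hU`), which is certified there
for `U ∈ [2, 4]`. But that simplicity is clause (W4) of the skeleton's `PlaquetteData U` — a HYPOTHESIS of the registered
stub `stub_plaquetteDictionary : ∀ U, 0 < U → PlaquetteData U → PlaquetteDictionary U`. This file re-derives the whole
symmetry chain with (W4) as hypotheses `h4`, `h2` in place of the window (proofs verbatim those of `…KernelSymmetry` /
`…KernelStructure`, which are the `U ∈ [2,4]` instances):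

* `plaquetteStates_eigenphase_of_unique` — plaquette automorphisms act on `|0h⟩`, `|2h⟩` by unimodular phases;
* `plaquetteKernel_mapEquiv_diag/_exchange_of_unique`, `plaquetteKernel_reflect_of_unique`,
  `plaquettePairCouplings_mu_symm_of_unique`, `plaquetteKernel_exchange_im_of_unique`,
  `plaquetteKernel_hop(')_eq_neg_J_of_unique`, `plaquetteKernel_vertical_diag/_exchange_of_unique`;
* the tables `plaquetteKernel_apply_of_unique`, `plaquetteKernelV_apply_of_unique` and the isotropy in the indexed form
  used by the locality files, `kernel_bonds_eq_plaquetteKernel_of_unique`.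

References: W.-F. Tsai, S. A. Kivelson, PRB 73 (2006) 214510, App. A (A1)–(A3) [TsaiKivelson2006]; H. Yao, W.-F. Tsai,
S. A. Kivelson, PRB 76 (2007) 161104(R), eq. (2) [YaoTsaiKivelson2007]; T. Kato (1966), I-§5.3. No definition and no
named fact is introduced.
-/

noncomputable section

set_option linter.dupNamespace false

namespace Summit.HubbardSuperconductivity.HubbardSuperconductivity.Theorems.LevyLogBootstrap

open Matrix Finset Literature.MathematicalPhysics.QuantumLattice Literature.Probability.LatticeModels
open scoped ComplexOrder

section KernelTableOfUnique

variable {U : ℝ}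
  (h4 : ∀ φ₁ φ₂ : Fock (Orb PlaquetteSite), IsGroundStateInSector (plaquetteHamiltonian U) 4 0 φ₁ →
    IsGroundStateInSector (plaquetteHamiltonian U) 4 0 φ₂ → ∃ a : ℂ, φ₂ = a • φ₁)
  (h2 : ∀ φ₁ φ₂ : Fock (Orb PlaquetteSite), IsGroundStateInSector (plaquetteHamiltonian U) 2 0 φ₁ →
    IsGroundStateInSector (plaquetteHamiltonian U) 2 0 φ₂ → ∃ a : ℂ, φ₂ = a • φ₁)
include h4 h2

/-! ### Symmetry-adapted plaquette states from (W4) -/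

/-- **The plaquette states are symmetry-adapted under (W4)**: for every automorphism `f` of the plaquette graph, the
second-quantised symmetry `Γ_f` maps `|0h⟩`, `|2h⟩` to unimodular multiples of themselves (it permutes the simple
`(4,0)` / `(2,0)` sector ground states). [cite: YaoTsaiKivelson2007, p. 2] -/
theorem plaquetteStates_eigenphase_of_unique (f : PlaquetteSite ≃ PlaquetteSite)
    (hG : ∀ x y, plaquetteGraph.Adj (f x) (f y) ↔ plaquetteGraph.Adj x y) :
    ∃ u : Fin 2 → ℂ, (∀ k, star (u k) * u k = 1) ∧
      ∀ k, fockMapOp (Orb.mapEquiv f) *ᵥ plaquetteStates U k = u k • plaquetteStates U k := by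
  have hΓ := conjTranspose_fockMapOp_mul_self (⇑(Orb.mapEquiv f)) (Orb.mapEquiv f).injective
  have h0 := (plaquetteVacuum_spec U).2.fockMapOp_mapEquiv_mulVec plaquetteGraph f hG
  have h1 := (plaquettePair_spec U).2.fockMapOp_mapEquiv_mulVec plaquetteGraph f hG
  obtain ⟨a₀, ha₀⟩ := h4 _ _ (plaquetteVacuum_spec U).2 h0
  obtain ⟨a₁, ha₁⟩ := h2 _ _ (plaquettePair_spec U).2 h1
  refine ⟨![a₀, a₁], ?_, ?_⟩
  · intro k
    fin_cases k
    · exact star_mul_self_eq_one_of_isometry_mulVec_eq_smul hΓ (plaquetteVacuum_spec U).1 ha₀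
    · exact star_mul_self_eq_one_of_isometry_mulVec_eq_smul hΓ (plaquettePair_spec U).1 ha₁
  · intro k
    fin_cases k
    · exact ha₀
    · exact ha₁

/-- Diagonal entries are invariant under pulling the bonds back along a plaquette automorphism, under (W4).
[cite: TsaiKivelson2006, App. A (A1)] -/
theorem plaquetteKernel_mapEquiv_diag_of_unique (f : PlaquetteSite ≃ PlaquetteSite)
    (hG : ∀ x y, plaquetteGraph.Adj (f x) (f y) ↔ plaquetteGraph.Adj x y) (κ : Fin 2 × Fin 2) :
    interClusterKernel (plaquetteHamiltonian_isHermitian U) (plaquetteStates U)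
        (fun i j => bondHopping plaquetteBonds (Orb.mapEquiv f i) (Orb.mapEquiv f j)) κ κ =
      plaquetteKernel U κ κ := by
  obtain ⟨u, hu, hφ⟩ := plaquetteStates_eigenphase_of_unique h4 h2 f hG
  exact interClusterKernel_comp_eq_of_eigenphase_diag (plaquetteHamiltonian_isHermitian U) (plaquetteStates U)
    (bondHopping plaquetteBonds) (conjTranspose_fockMapOp_mul_self _ (Orb.mapEquiv f).injective)
    (fockMapOp_mapEquiv_mul_hamiltonian plaquetteGraph plaquetteGraph f hG 1 U) (Orb.mapEquiv f)
    (fun i => fockMapOp_mul_annihilation _ (Orb.mapEquiv f).bijective i)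
    (fun i => fockMapOp_mul_creation _ i) u hu hφ κ

/-- Exchange entries are invariant under pulling the bonds back along a plaquette automorphism, under (W4).
[cite: TsaiKivelson2006, App. A (A1)] -/
theorem plaquetteKernel_mapEquiv_exchange_of_unique (f : PlaquetteSite ≃ PlaquetteSite)
    (hG : ∀ x y, plaquetteGraph.Adj (f x) (f y) ↔ plaquetteGraph.Adj x y) (k l : Fin 2) :
    interClusterKernel (plaquetteHamiltonian_isHermitian U) (plaquetteStates U)
        (fun i j => bondHopping plaquetteBonds (Orb.mapEquiv f i) (Orb.mapEquiv f j)) (k, l) (l, k) =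
      plaquetteKernel U (k, l) (l, k) := by
  obtain ⟨u, hu, hφ⟩ := plaquetteStates_eigenphase_of_unique h4 h2 f hG
  exact interClusterKernel_comp_eq_of_eigenphase_exchange (plaquetteHamiltonian_isHermitian U) (plaquetteStates U)
    (bondHopping plaquetteBonds) (conjTranspose_fockMapOp_mul_self _ (Orb.mapEquiv f).injective)
    (fockMapOp_mapEquiv_mul_hamiltonian plaquetteGraph plaquetteGraph f hG 1 U) (Orb.mapEquiv f)
    (fun i => fockMapOp_mul_annihilation _ (Orb.mapEquiv f).bijective i)
    (fun i => fockMapOp_mul_creation _ i) u hu hφ k l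

/-! ### Reflection symmetry, reality of the pair hopping, isotropy — under (W4) -/

/-- Reflection symmetry of the second-order shifts under (W4): `K((k,l),(k,l)) = K((l,k),(l,k))`.
[cite: TsaiKivelson2006, App. A (A1)] -/
theorem plaquetteKernel_reflect_of_unique (k l : Fin 2) :
    plaquetteKernel U (k, l) (k, l) = plaquetteKernel U (l, k) (l, k) := by
  rw [plaquetteKernel, ← interClusterKernel_swap_diag (plaquetteHamiltonian_isHermitian U) (plaquetteStates U)
    (bondHopping plaquetteBonds) k l, ← bondHopping_plaquetteBonds_xShift]
  exact plaquetteKernel_mapEquiv_diag_of_unique h4 h2 plaquetteXShift plaquetteGraph_adj_xShift (l, k)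

/-- The two one-body shifts of a bond agree under (W4): `μ = Re [K(0,1) − K(0,0)]`. [cite: YaoTsaiKivelson2007, eq. (2)] -/
theorem plaquettePairCouplings_mu_symm_of_unique :
    (plaquettePairCouplings U).μ = (plaquetteKernel U (0, 1) (0, 1)).re - (plaquetteKernel U (0, 0) (0, 0)).re := by
  simp only [plaquettePairCouplings]
  rw [plaquetteKernel_reflect_of_unique h4 h2 1 0]

/-- The exchange entries are real under (W4): `Im K((k,l),(l,k)) = 0`. [cite: TsaiKivelson2006, App. A (A1)] -/
theorem plaquetteKernel_exchange_im_of_unique (k l : Fin 2) : (plaquetteKernel U (k, l) (l, k)).im = 0 := by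
  have h : plaquetteKernel U (k, l) (l, k) = star (plaquetteKernel U (k, l) (l, k)) := by
    conv_lhs => rw [← plaquetteKernel_mapEquiv_exchange_of_unique h4 h2 plaquetteXShift plaquetteGraph_adj_xShift k l,
      bondHopping_plaquetteBonds_xShift]
    exact interClusterKernel_swap_exchange (plaquetteHamiltonian_isHermitian U) (plaquetteStates U)
      (bondHopping plaquetteBonds) k l
  have him := congrArg Complex.im h
  rw [Complex.star_def, Complex.conj_im] at him
  linarith

/-- The pair-hopping entry is exactly `-J(U)` under (W4). [cite: YaoTsaiKivelson2007, eq. (2)] -/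
theorem plaquetteKernel_hop_eq_neg_J_of_unique :
    plaquetteKernel U (1, 0) (0, 1) = -(((plaquettePairCouplings U).J : ℝ) : ℂ) := by
  refine Complex.ext ?_ ?_
  · rw [plaquetteKernel_hop_re, Complex.neg_re, Complex.ofReal_re]
  · rw [plaquetteKernel_exchange_im_of_unique h4 h2 1 0, Complex.neg_im, Complex.ofReal_im, neg_zero]

/-- The reverse hopping entry is `-J(U)` under (W4). [cite: YaoTsaiKivelson2007, eq. (2)] -/
theorem plaquetteKernel_hop'_eq_neg_J_of_unique :
    plaquetteKernel U (0, 1) (1, 0) = -(((plaquettePairCouplings U).J : ℝ) : ℂ) := by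
  rw [← star_plaquetteKernel, plaquetteKernel_hop_eq_neg_J_of_unique h4 h2, star_neg, Complex.star_def,
    Complex.conj_ofReal]

/-- The two exchange entries are both `-J(U)` under (W4). [cite: YaoTsaiKivelson2007, eq. (2)] -/
theorem plaquetteKernel_exchange_eq_neg_J_of_unique (κ' : Fin 2 × Fin 2) (h : κ'.1 ≠ κ'.2) :
    plaquetteKernel U κ' κ'.swap = -(((plaquettePairCouplings U).J : ℝ) : ℂ) := by
  rcases κ' with ⟨a, b⟩
  fin_cases a <;> fin_cases b
  · exact absurd rfl h
  · exact plaquetteKernel_hop'_eq_neg_J_of_unique h4 h2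
  · exact plaquetteKernel_hop_eq_neg_J_of_unique h4 h2
  · exact absurd rfl h

/-- Isotropy of the shifts under (W4): the vertical kernel has the diagonal of the horizontal table.
[cite: YaoTsaiKivelson2007, eq. (2)] -/
theorem plaquetteKernel_vertical_diag_of_unique (κ : Fin 2 × Fin 2) :
    interClusterKernel (plaquetteHamiltonian_isHermitian U) (plaquetteStates U) (bondHopping plaquetteBondsV) κ κ =
      plaquetteKernel U κ κ := by
  rw [← bondHopping_plaquetteBonds_diagSwap]
  exact plaquetteKernel_mapEquiv_diag_of_unique h4 h2 plaquetteDiagSwap plaquetteGraph_adj_diagSwap κ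

/-- Isotropy of the pair hopping under (W4): the vertical kernel has the exchange entries of the horizontal table.
[cite: YaoTsaiKivelson2007, eq. (2)] -/
theorem plaquetteKernel_vertical_exchange_of_unique (k l : Fin 2) :
    interClusterKernel (plaquetteHamiltonian_isHermitian U) (plaquetteStates U) (bondHopping plaquetteBondsV)
        (k, l) (l, k) = plaquetteKernel U (k, l) (l, k) := by
  rw [← bondHopping_plaquetteBonds_diagSwap]
  exact plaquetteKernel_mapEquiv_exchange_of_unique h4 h2 plaquetteDiagSwap plaquetteGraph_adj_diagSwap k l

/-! ### The complete tables under (W4) -/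

/-- **The two-plaquette kernel is the one-bond hard-core boson Hamiltonian, under (W4)**:
`K(κ', κ) = if κ' = κ then Re K(κ,κ) else if (κ'.1 ≠ κ'.2 ∧ κ = κ'.swap) then -J(U) else 0`.
[cite: YaoTsaiKivelson2007, eq. (2)] -/
theorem plaquetteKernel_apply_of_unique (κ' κ : Fin 2 × Fin 2) :
    plaquetteKernel U κ' κ =
      if κ' = κ then (((plaquetteKernel U κ κ).re : ℝ) : ℂ)
      else if κ'.1 ≠ κ'.2 ∧ κ = κ'.swap then -(((plaquettePairCouplings U).J : ℝ) : ℂ) else 0 := by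
  by_cases h1 : κ' = κ
  · subst h1
    rw [if_pos rfl]
    exact plaquetteKernel_diag_eq_re U κ'
  · rw [if_neg h1]
    by_cases h3 : κ'.1 ≠ κ'.2 ∧ κ = κ'.swap
    · rw [if_pos h3, h3.2]
      exact plaquetteKernel_exchange_eq_neg_J_of_unique h4 h2 κ' h3.1
    · rw [if_neg h3]
      exact plaquetteKernel_eq_zero U κ' κ h1 h3

/-- **The same table on vertical bonds, under (W4).** [cite: YaoTsaiKivelson2007, eq. (2)] -/
theorem plaquetteKernelV_apply_of_unique (κ' κ : Fin 2 × Fin 2) :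
    interClusterKernel (plaquetteHamiltonian_isHermitian U) (plaquetteStates U) (bondHopping plaquetteBondsV) κ' κ =
      if κ' = κ then (((plaquetteKernel U κ κ).re : ℝ) : ℂ)
      else if κ'.1 ≠ κ'.2 ∧ κ = κ'.swap then -(((plaquettePairCouplings U).J : ℝ) : ℂ) else 0 := by
  by_cases h1 : κ' = κ
  · subst h1
    rw [if_pos rfl, plaquetteKernel_vertical_diag_of_unique h4 h2 κ']
    exact plaquetteKernel_diag_eq_re U κ'
  · rw [if_neg h1]
    by_cases h3 : κ'.1 ≠ κ'.2 ∧ κ = κ'.swap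
    · rw [if_pos h3, h3.2]
      rcases κ' with ⟨a, b⟩
      have hab : a ≠ b := h3.1
      fin_cases a <;> fin_cases b
      · exact absurd rfl hab
      · have h := star_interClusterKernel (plaquetteHamiltonian_isHermitian U) (plaquetteStates U)
          (bondHopping plaquetteBondsV) ((1 : Fin 2), (0 : Fin 2)) ((0 : Fin 2), (1 : Fin 2))
        rw [plaquetteKernel_vertical_exchange_of_unique h4 h2 1 0, plaquetteKernel_hop_eq_neg_J_of_unique h4 h2,
          star_neg, Complex.star_def, Complex.conj_ofReal] at h
        exact h.symm
      · exact (plaquetteKernel_vertical_exchange_of_unique h4 h2 1 0).trans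
          (plaquetteKernel_hop_eq_neg_J_of_unique h4 h2)
      · exact absurd rfl hab
    · rw [if_neg h3]
      exact plaquetteKernelV_eq_zero U κ' κ h1 h3

/-- **Isotropy in indexed form, under (W4)**: on horizontal (`k = 0`, `plaquetteBonds`) and vertical (`k = 1`,
`plaquetteBondsV`) superlattice bonds Kato's kernel is the same table `plaquetteKernel U`. [cite: YaoTsaiKivelson2007, eq. (2)] -/
theorem kernel_bonds_eq_plaquetteKernel_of_unique (k : Fin 2) (κ' κ : Fin 2 × Fin 2) :
    interClusterKernel (plaquetteHamiltonian_isHermitian U) (plaquetteStates U)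
        (bondHopping ((![plaquetteBonds, plaquetteBondsV] : Fin 2 → Finset (PlaquetteSite × PlaquetteSite)) k)) κ' κ =
      plaquetteKernel U κ' κ := by
  fin_cases k
  · rfl
  · exact (plaquetteKernelV_apply_of_unique h4 h2 κ' κ).trans (plaquetteKernel_apply_of_unique h4 h2 κ' κ).symm

end KernelTableOfUnique

end Summit.HubbardSuperconductivity.HubbardSuperconductivity.Theorems.LevyLogBootstrap

end
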